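import Summits.CriticalPhenomena.PercolationContinuityZ3.Theorems.Transplant.SkelNegBParamsRootVals
import Summits.CriticalPhenomena.PercolationContinuityZ3.Theorems.Transplant.SkelNegBParamsRootArithY3
import Summits.CriticalPhenomena.PercolationContinuityZ3.Theorems.Transplant.SkelNegBParamsSlotsT
import HarnessLib

/-!
# N1 params, chain of record `NegB`, part RootFineYP: THE x-PREFIX OF THE y-FAMILY AT THE LEDGER (`Nx := 3`) — p3's `hPf₁/hPf₂` (vertical `du`: the prism's
# LEVEL reading in `[−5r₁+1, 25r₁−1]`) and `hPf₃` (the prism's fine abscissa within `±(5r₀ − 2)`) of `rootOblTWAt_negBT_y` in LITERAL shape, at the x-origin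
# `y` (any `Site 2` with `|Λ₀(y)| ≤ 3m`, `|Λ₁(y)| ≤ 2m`), start half-width `qB` (`4qB ≤ n_L`), boxes `KS.paLo/paHi … qB 3`, `KS.pbHi … 3` (part RootVals with `Nr := 3`)

builds on p205010 (kernel theorem, internal audit signed; external expert review pending) — nothing in this file uses p205010; NOTHING is claimed about
the node `SamePDropOfSkeletonNeg₁` (OPEN).  Pure instantiation of parts RootArithP / RootArithY3.
Lane `prim-bschramm-*`, seat `prim-bschramm-stmt` (gen 14); helper file (`--supports stmt-CriticalPhenomena-4575 --as helper`); ledger HOME/prim-bschramm-stmt/NEG-PARAMS.md v0.13.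
[cite: KozmaNitzan2024, §4 p. 28 ((32) at the root)] [cite: MartineauTassion2017, §4.3 Lemma 4.2]
-/

noncomputable section

open scoped Classical

namespace Summit.CriticalPhenomena.PercolationContinuityZ3.Theorems.Transplant

namespace PlanarSkeletonNeg

namespace NegB

open Literature.Probability.Percolation Literature.Probability.LatticeModels SimpleGraph
open SkelConc (Consts)
open Skelφ (shearUnit shearUnit_pos)
open Skelφ.StepI (DataN)
open TwoAxis.Para (modulus)
open Neg

namespace KS

section AtT

variable (κ : Consts) {V : Type} [DecidableEq V] [Countable V] {G : SimpleGraph V} [G.LocallyFinite] (Φ : PlanarSkeletonNeg G) (t : V)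
  (p : unitInterval) (D : DataN V) (mk : ℕ) (gx fx : Neg.FSlot)

/-- **The x-prefix prism's LEVEL reading** (either `σ`, `Nx = 3`): inside `±(5r₁ − 2)` — gives p3's `hPf₁` (`σ = 1`) and `hPf₂` (`σ = −1`) for vertical `du`.
[cite: KozmaNitzan2024, §4 p. 28] -/
theorem hPfX_lev_R (hN : EqNumL κ Φ t p D (gT mk gx κ Φ t p D) (fT mk fx κ Φ t p D)) (hκ : (hL κ Φ t p D (gT mk gx κ Φ t p D) (fT mk fx κ Φ t p D)).natAbs ≤ 10 * nL κ Φ t p D (gT mk gx κ Φ t p D) (fT mk fx κ Φ t p D))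
    (y : Site 2) (qB : ℕ) (hq : 4 * qB ≤ nL κ Φ t p D (gT mk gx κ Φ t p D) (fT mk fx κ Φ t p D)) {σ : ℤ} (hσ : σ = 1 ∨ σ = -1)
    (hΛ₁ : |Λ₁of κ Φ t p D (gT mk gx κ Φ t p D) (fT mk fx κ Φ t p D) y| ≤ 2 * modulus (nL κ Φ t p D (gT mk gx κ Φ t p D) (fT mk fx κ Φ t p D)) (hL κ Φ t p D (gT mk gx κ Φ t p D) (fT mk fx κ Φ t p D)) (vL κ Φ t p D (gT mk gx κ Φ t p D) (fT mk fx κ Φ t p D)) (Skelφ.NegPrm.vβOf (nL κ Φ t p D (gT mk gx κ Φ t p D) (fT mk fx κ Φ t p D)) (hL κ Φ t p D (gT mk gx κ Φ t p D) (fT mk fx κ Φ t p D)) (ℓL κ Φ t p D (gT mk gx κ Φ t p D) (fT mk fx κ Φ t p D)) (vL κ Φ t p D (gT mk gx κ Φ t p D) (fT mk fx κ Φ t p D)))) :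
    -(5 * ((fcells κ Φ t p D (gT mk gx κ Φ t p D) (fT mk fx κ Φ t p D)).r 1 : ℤ) - 2) ≤ TwoAxis.Para.coarse (20 * ((fcells κ Φ t p D (gT mk gx κ Φ t p D) (fT mk fx κ Φ t p D)).K : ℤ) * (((fcells κ Φ t p D (gT mk gx κ Φ t p D) (fT mk fx κ Φ t p D)).s 1 : ℕ) : ℤ)) (Skelφ.NegPrm.Dof (nL κ Φ t p D (gT mk gx κ Φ t p D) (fT mk fx κ Φ t p D)) (hL κ Φ t p D (gT mk gx κ Φ t p D) (fT mk fx κ Φ t p D)) (ℓL κ Φ t p D (gT mk gx κ Φ t p D) (fT mk fx κ Φ t p D)) (vL κ Φ t p D (gT mk gx κ Φ t p D) (fT mk fx κ Φ t p D)) / 2) (Skelφ.NegPrm.Dof (nL κ Φ t p D (gT mk gx κ Φ t p D) (fT mk fx κ Φ t p D)) (hL κ Φ t p D (gT mk gx κ Φ t p D) (fT mk fx κ Φ t p D)) (ℓL κ Φ t p D (gT mk gx κ Φ t p D) (fT mk fx κ Φ t p D)) (vL κ Φ t p D (gT mk gx κ Φ t p D) (fT mk fx κ Φ t p D))) (TwoAxis.Para.lam1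 800 (nL κ Φ t p D (gT mk gx κ Φ t p D) (fT mk fx κ Φ t p D) : ℤ) (hL κ Φ t p D (gT mk gx κ Φ t p D) (fT mk fx κ Φ t p D)) y) + ((20 * ((fcells κ Φ t p D (gT mk gx κ Φ t p D) (fT mk fx κ Φ t p D)).K : ℤ) * (((fcells κ Φ t p D (gT mk gx κ Φ t p D) (fT mk fx κ Φ t p D)).s 1 : ℕ) : ℤ)) * (800 * ((shearUnit (nL κ Φ t p D (gT mk gx κ Φ t p D) (fT mk fx κ Φ t p D)) (hL κ Φ t p D (gT mk gx κ Φ t p D) (fT mk fx κ Φ t p D)) : ℤ) * (min (σ * (-pbHi κ Φ t p D (gT mk gx κ Φ t p D) (fT mk fx κ Φ t p D) mk 3)) (σ * (pbHi κ Φ t p D (gT mk gx κ Φ t p D) (fT mk fx κ Φ t p D) mk 3)) - 1)))) / (Skelφ.NegPrm.Dof (nL κ Φ t p D (gT mk gx κ Φ t p D) (fT mk fx κ Φ t p D)) (hL κ Φ t p D (gT mk gx κ Φ t p D) (fT mk fx κ Φ t p D)) (ℓL κ Φ t p D (gT mk gx κ Φ t p D) (fT mk fx κ Φ t p D)) (vL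 κ Φ t p D (gT mk gx κ Φ t p D) (fT mk fx κ Φ t p D))) ∧
      TwoAxis.Para.coarse (20 * ((fcells κ Φ t p D (gT mk gx κ Φ t p D) (fT mk fx κ Φ t p D)).K : ℤ) * (((fcells κ Φ t p D (gT mk gx κ Φ t p D) (fT mk fx κ Φ t p D)).s 1 : ℕ) : ℤ)) (Skelφ.NegPrm.Dof (nL κ Φ t p D (gT mk gx κ Φ t p D) (fT mk fx κ Φ t p D)) (hL κ Φ t p D (gT mk gx κ Φ t p D) (fT mk fx κ Φ t p D)) (ℓL κ Φ t p D (gT mk gx κ Φ t p D) (fT mk fx κ Φ t p D)) (vL κ Φ t p D (gT mk gx κ Φ t p D) (fT mk fx κ Φ t p D)) / 2) (Skelφ.NegPrm.Dof (nL κ Φ t p D (gT mk gx κ Φ t p D) (fT mk fx κ Φ t p D)) (hL κ Φ t p D (gT mk gx κ Φ t p D) (fT mk fx κ Φ t p D)) (ℓL κ Φ t p D (gT mk gx κ Φ t p D) (fT mk fx κ Φ t p D)) (vL κ Φ t p D (gT mk gx κ Φ t p D) (fT mk fx κ Φ t p D))) (TwoAxis.Para.lam1 800 (nL κ Φ t p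 D (gT mk gx κ Φ t p D) (fT mk fx κ Φ t p D) : ℤ) (hL κ Φ t p D (gT mk gx κ Φ t p D) (fT mk fx κ Φ t p D)) y) +
        ((20 * ((fcells κ Φ t p D (gT mk gx κ Φ t p D) (fT mk fx κ Φ t p D)).K : ℤ) * (((fcells κ Φ t p D (gT mk gx κ Φ t p D) (fT mk fx κ Φ t p D)).s 1 : ℕ) : ℤ)) * (800 * ((shearUnit (nL κ Φ t p D (gT mk gx κ Φ t p D) (fT mk fx κ Φ t p D)) (hL κ Φ t p D (gT mk gx κ Φ t p D) (fT mk fx κ Φ t p D)) : ℤ) * (max (σ * (-pbHi κ Φ t p D (gT mk gx κ Φ t p D) (fT mk fx κ Φ t p D) mk 3)) (σ * (pbHi κ Φ t p D (gT mk gx κ Φ t p D) (fT mk fx κ Φ t p D) mk 3))) + (shearUnit (nL κ Φ t p D (gT mk gx κ Φ t p D) (fT mk fx κ Φ t p D)) (hL κ Φ t p D (gT mk gx κ Φ t p D) (fT mk fx κ Φ t p D)) : ℤ) - 1))) / (Skelφ.NegPrm.Dof (nL κ Φ t p D (gT mk gx κ Φ t p D) (fT mk fx κ Φ t p D)) (hL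 κ Φ t p D (gT mk gx κ Φ t p D) (fT mk fx κ Φ t p D)) (ℓL κ Φ t p D (gT mk gx κ Φ t p D) (fT mk fx κ Φ t p D)) (vL κ Φ t p D (gT mk gx κ Φ t p D) (fT mk fx κ Φ t p D))) + 1 ≤
        5 * ((fcells κ Φ t p D (gT mk gx κ Φ t p D) (fT mk fx κ Φ t p D)).r 1 : ℤ) - 2 := by
  obtain ⟨hn1, hℓ1⟩ := one_le_of_eqNumL κ Φ t p D _ _ hN
  have hm0 := (Skelφ.NegPrm.modulus_vβOf hn1 (hL κ Φ t p D (gT mk gx κ Φ t p D) (fT mk fx κ Φ t p D)) (ℓL κ Φ t p D (gT mk gx κ Φ t p D) (fT mk fx κ Φ t p D)) (vL κ Φ t p D (gT mk gx κ Φ t p D) (fT mk fx κ Φ t p D))).1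
  have hm : (nL κ Φ t p D (gT mk gx κ Φ t p D) (fT mk fx κ Φ t p D) : ℤ) * ((ℓL κ Φ t p D (gT mk gx κ Φ t p D) (fT mk fx κ Φ t p D) : ℤ) - 1) < modulus (nL κ Φ t p D (gT mk gx κ Φ t p D) (fT mk fx κ Φ t p D)) (hL κ Φ t p D (gT mk gx κ Φ t p D) (fT mk fx κ Φ t p D)) (vL κ Φ t p D (gT mk gx κ Φ t p D) (fT mk fx κ Φ t p D)) (Skelφ.NegPrm.vβOf (nL κ Φ t p D (gT mk gx κ Φ t p D) (fT mk fx κ Φ t p D)) (hL κ Φ t p D (gT mk gx κ Φ t p D) (fT mk fx κ Φ t p D)) (ℓL κ Φ t p D (gT mk gx κ Φ t p D) (fT mk fx κ Φ t p D)) (vL κ Φ t p D (gT mk gx κ Φ t p D) (fT mk fx κ Φ t p D))) := by linarith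
  obtain ⟨hc0, hc1, hr0, hr1, hb0, hb1, hu0, hu1⟩ := units_eq κ Φ t p D (gT mk gx κ Φ t p D) (fT mk fx κ Φ t p D)
  have hv : |(vL κ Φ t p D (gT mk gx κ Φ t p D) (fT mk fx κ Φ t p D))| ≤ (nL κ Φ t p D (gT mk gx κ Φ t p D) (fT mk fx κ Φ t p D) : ℤ) := hN.v_le
  have hn : (1 : ℤ) ≤ (nL κ Φ t p D (gT mk gx κ Φ t p D) (fT mk fx κ Φ t p D) : ℤ) := by exact_mod_cast hn1
  have hsu : (nL κ Φ t p D (gT mk gx κ Φ t p D) (fT mk fx κ Φ t p D) : ℤ) ≤ (shearUnit (nL κ Φ t p D (gT mk gx κ Φ t p D) (fT mk fx κ Φ t p D)) (hL κ Φ t p D (gT mk gx κ Φ t p D) (fT mk fx κ Φ t p D)) : ℤ) ∧ (shearUnit (nL κ Φ t p D (gT mk gx κ Φ t p D) (fT mk fx κ Φ t p D)) (hL κ Φ t p D (gT mk gx κ Φ t p D) (fT mk fx κ Φ t p D)) : ℤ) ≤ 11 * (nL κ Φ t p D (gT mk gx κ Φ t p D) (fT mk fx κ Φ t p D) : ℤ)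 := by
    have h10 : ((((hL κ Φ t p D (gT mk gx κ Φ t p D) (fT mk fx κ Φ t p D))).natAbs : ℤ)) ≤ 10 * (nL κ Φ t p D (gT mk gx κ Φ t p D) (fT mk fx κ Φ t p D) : ℤ) := by exact_mod_cast hκ
    have h0 : (0 : ℤ) ≤ ((((hL κ Φ t p D (gT mk gx κ Φ t p D) (fT mk fx κ Φ t p D))).natAbs : ℤ)) := Nat.cast_nonneg _
    unfold Skelφ.shearUnit
    simp only [Nat.cast_add]
    constructor <;> linarith
  obtain ⟨hW, hLb⟩ := Wrun_spec κ Φ t p D (gT mk gx κ Φ t p D) (fT mk fx κ Φ t p D) hn1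
  have hW0 : (0 : ℤ) ≤ (Wrun κ Φ t p D (gT mk gx κ Φ t p D) (fT mk fx κ Φ t p D) : ℤ) := Nat.cast_nonneg _
  have hLb0 : (0 : ℤ) ≤ (Lbrun κ Φ t p D (gT mk gx κ Φ t p D) (fT mk fx κ Φ t p D) : ℤ) := Nat.cast_nonneg _
  have hRA : (0 : ℤ) ≤ (RA' κ Φ t p D mk : ℤ) := Nat.cast_nonneg _
  have hRAn : 2000 * ((RA' κ Φ t p D mk : ℤ) + 2) ≤ (nL κ Φ t p D (gT mk gx κ Φ t p D) (fT mk fx κ Φ t p D) : ℤ) := by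
    have := (nL_floorsT κ Φ t p D mk fx (gT mk gx κ Φ t p D)).2.1; exact_mod_cast this
  have hRAℓ : 22000 * ((RA' κ Φ t p D mk : ℤ) + 2) ≤ (ℓL κ Φ t p D (gT mk gx κ Φ t p D) (fT mk fx κ Φ t p D) : ℤ) := by
    have h1 : ((22000 * (RA' κ Φ t p D mk + 2) : ℕ) : ℤ) ≤ (ML κ Φ t p D (gT mk gx κ Φ t p D) : ℤ) := by exact_mod_cast (ML_floorsT κ Φ t p D mk gx).2.1
    have h2 := hN.ℓ_le
    push_cast at h1; linarith
  have hq0 : (0 : ℤ) ≤ (qB : ℤ) := Nat.cast_nonneg _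
  have hq' : 4 * (qB : ℤ) ≤ (nL κ Φ t p D (gT mk gx κ Φ t p D) (fT mk fx κ Φ t p D) : ℤ) := by exact_mod_cast hq
  unfold pbHi TwoAxis.Para.coarse
  rw [hc1, Dof_eq', (lam_eq κ Φ t p D (gT mk gx κ Φ t p D) (fT mk fx κ Φ t p D) y).2]
  have e3 : -(5 * ((fcells κ Φ t p D (gT mk gx κ Φ t p D) (fT mk fx κ Φ t p D)).r 1 : ℤ) - 2) = -(5 * (40 * u₁ κ Φ t p D (gT mk gx κ Φ t p D) (fT mk fx κ Φ t p D)) - 2) := by rw [hr1]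
  have e4 : 5 * ((fcells κ Φ t p D (gT mk gx κ Φ t p D) (fT mk fx κ Φ t p D)).r 1 : ℤ) - 2 = 5 * (40 * u₁ κ Φ t p D (gT mk gx κ Φ t p D) (fT mk fx κ Φ t p D)) - 2 := by rw [hr1]
  rw [e3, e4]
  exact RootArith.trans_prism (u := u₁ κ Φ t p D (gT mk gx κ Φ t p D) (fT mk fx κ Φ t p D)) (Λ := Λ₁of κ Φ t p D (gT mk gx κ Φ t p D) (fT mk fx κ Φ t p D) y) (v := (vL κ Φ t p D (gT mk gx κ Φ t p D) (fT mk fx κ Φ t p D))) (N := ((3 : ℕ) : ℤ)) hu1 hn hm hsu.1 hsu.2 hv hW hW0 hLb hLb0 hRA hRAℓ (by norm_num) (by norm_num) hσ hΛ₁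

/-- **`hPf₁` of the y-family's x-prefix** (`σ = 1`, vertical `du`): `−5r₁ + 1 ≤ PLO₁`, `PHI₁ ≤ 25r₁ − 1`. [cite: KozmaNitzan2024, §4 p. 28] -/
theorem hPfX₁_R (hN : EqNumL κ Φ t p D (gT mk gx κ Φ t p D) (fT mk fx κ Φ t p D)) (hκ : (hL κ Φ t p D (gT mk gx κ Φ t p D) (fT mk fx κ Φ t p D)).natAbs ≤ 10 * nL κ Φ t p D (gT mk gx κ Φ t p D) (fT mk fx κ Φ t p D))
    (y : Site 2) (qB : ℕ) (hq : 4 * qB ≤ nL κ Φ t p D (gT mk gx κ Φ t p D) (fT mk fx κ Φ t p D)) {σ : ℤ} (hσ : σ = 1 ∨ σ = -1)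
    (hΛ₁ : |Λ₁of κ Φ t p D (gT mk gx κ Φ t p D) (fT mk fx κ Φ t p D) y| ≤ 2 * modulus (nL κ Φ t p D (gT mk gx κ Φ t p D) (fT mk fx κ Φ t p D)) (hL κ Φ t p D (gT mk gx κ Φ t p D) (fT mk fx κ Φ t p D)) (vL κ Φ t p D (gT mk gx κ Φ t p D) (fT mk fx κ Φ t p D)) (Skelφ.NegPrm.vβOf (nL κ Φ t p D (gT mk gx κ Φ t p D) (fT mk fx κ Φ t p D)) (hL κ Φ t p D (gT mk gx κ Φ t p D) (fT mk fx κ Φ t p D)) (ℓL κ Φ t p D (gT mk gx κ Φ t p D) (fT mk fx κ Φ t p D)) (vL κ Φ t p D (gT mk gx κ Φ t p D) (fT mk fx κ Φ t p D)))) (hσ1 : σ = 1) :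
    -(5 * ((fcells κ Φ t p D (gT mk gx κ Φ t p D) (fT mk fx κ Φ t p D)).r 1 : ℤ)) + 1 ≤ TwoAxis.Para.coarse (20 * ((fcells κ Φ t p D (gT mk gx κ Φ t p D) (fT mk fx κ Φ t p D)).K : ℤ) * (((fcells κ Φ t p D (gT mk gx κ Φ t p D) (fT mk fx κ Φ t p D)).s 1 : ℕ) : ℤ)) (Skelφ.NegPrm.Dof (nL κ Φ t p D (gT mk gx κ Φ t p D) (fT mk fx κ Φ t p D)) (hL κ Φ t p D (gT mk gx κ Φ t p D) (fT mk fx κ Φ t p D)) (ℓL κ Φ t p D (gT mk gx κ Φ t p D) (fT mk fx κ Φ t p D)) (vL κ Φ t p D (gT mk gx κ Φ t p D) (fT mk fx κ Φ t p D)) / 2) (Skelφ.NegPrm.Dof (nL κ Φ t p D (gT mk gx κ Φ t p D) (fT mk fx κ Φ t p D)) (hL κ Φ t p D (gT mk gx κ Φ t p D) (fT mk fx κ Φ t p D)) (ℓL κ Φ t p D (gT mk gx κ Φ t p D) (fT mk fx κ Φ t p D)) (vL κ Φ t p D (gT mk gx κ Φ t p D) (fT mk fx κ Φ t p D))) (TwoAxis.Para.lam1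 800 (nL κ Φ t p D (gT mk gx κ Φ t p D) (fT mk fx κ Φ t p D) : ℤ) (hL κ Φ t p D (gT mk gx κ Φ t p D) (fT mk fx κ Φ t p D)) y) + ((20 * ((fcells κ Φ t p D (gT mk gx κ Φ t p D) (fT mk fx κ Φ t p D)).K : ℤ) * (((fcells κ Φ t p D (gT mk gx κ Φ t p D) (fT mk fx κ Φ t p D)).s 1 : ℕ) : ℤ)) * (800 * ((shearUnit (nL κ Φ t p D (gT mk gx κ Φ t p D) (fT mk fx κ Φ t p D)) (hL κ Φ t p D (gT mk gx κ Φ t p D) (fT mk fx κ Φ t p D)) : ℤ) * (min (σ * (-pbHi κ Φ t p D (gT mk gx κ Φ t p D) (fT mk fx κ Φ t p D) mk 3)) (σ * (pbHi κ Φ t p D (gT mk gx κ Φ t p D) (fT mk fx κ Φ t p D) mk 3)) - 1)))) / (Skelφ.NegPrm.Dof (nL κ Φ t p D (gT mk gx κ Φ t p D) (fT mk fx κ Φ t p D)) (hL κ Φ t p D (gT mk gx κ Φ t p D) (fT mk fx κ Φ t p D)) (ℓL κ Φ t p D (gT mk gx κ Φ t p D) (fT mk fx κ Φ t p D)) (vL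 κ Φ t p D (gT mk gx κ Φ t p D) (fT mk fx κ Φ t p D))) ∧
      TwoAxis.Para.coarse (20 * ((fcells κ Φ t p D (gT mk gx κ Φ t p D) (fT mk fx κ Φ t p D)).K : ℤ) * (((fcells κ Φ t p D (gT mk gx κ Φ t p D) (fT mk fx κ Φ t p D)).s 1 : ℕ) : ℤ)) (Skelφ.NegPrm.Dof (nL κ Φ t p D (gT mk gx κ Φ t p D) (fT mk fx κ Φ t p D)) (hL κ Φ t p D (gT mk gx κ Φ t p D) (fT mk fx κ Φ t p D)) (ℓL κ Φ t p D (gT mk gx κ Φ t p D) (fT mk fx κ Φ t p D)) (vL κ Φ t p D (gT mk gx κ Φ t p D) (fT mk fx κ Φ t p D)) / 2) (Skelφ.NegPrm.Dof (nL κ Φ t p D (gT mk gx κ Φ t p D) (fT mk fx κ Φ t p D)) (hL κ Φ t p D (gT mk gx κ Φ t p D) (fT mk fx κ Φ t p D)) (ℓL κ Φ t p D (gT mk gx κ Φ t p D) (fT mk fx κ Φ t p D)) (vL κ Φ t p D (gT mk gx κ Φ t p D) (fT mk fx κ Φ t p D))) (TwoAxis.Para.lam1 800 (nL κ Φ t p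 D (gT mk gx κ Φ t p D) (fT mk fx κ Φ t p D) : ℤ) (hL κ Φ t p D (gT mk gx κ Φ t p D) (fT mk fx κ Φ t p D)) y) +
        ((20 * ((fcells κ Φ t p D (gT mk gx κ Φ t p D) (fT mk fx κ Φ t p D)).K : ℤ) * (((fcells κ Φ t p D (gT mk gx κ Φ t p D) (fT mk fx κ Φ t p D)).s 1 : ℕ) : ℤ)) * (800 * ((shearUnit (nL κ Φ t p D (gT mk gx κ Φ t p D) (fT mk fx κ Φ t p D)) (hL κ Φ t p D (gT mk gx κ Φ t p D) (fT mk fx κ Φ t p D)) : ℤ) * (max (σ * (-pbHi κ Φ t p D (gT mk gx κ Φ t p D) (fT mk fx κ Φ t p D) mk 3)) (σ * (pbHi κ Φ t p D (gT mk gx κ Φ t p D) (fT mk fx κ Φ t p D) mk 3))) + (shearUnit (nL κ Φ t p D (gT mk gx κ Φ t p D) (fT mk fx κ Φ t p D)) (hL κ Φ t p D (gT mk gx κ Φ t p D) (fT mk fx κ Φ t p D)) : ℤ) - 1))) / (Skelφ.NegPrm.Dof (nL κ Φ t p D (gT mk gx κ Φ t p D) (fT mk fx κ Φ t p D)) (hL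 κ Φ t p D (gT mk gx κ Φ t p D) (fT mk fx κ Φ t p D)) (ℓL κ Φ t p D (gT mk gx κ Φ t p D) (fT mk fx κ Φ t p D)) (vL κ Φ t p D (gT mk gx κ Φ t p D) (fT mk fx κ Φ t p D))) + 1 ≤
        25 * ((fcells κ Φ t p D (gT mk gx κ Φ t p D) (fT mk fx κ Φ t p D)).r 1 : ℤ) - 1 := by
  have _h := hσ1
  obtain ⟨h1, h2⟩ := hPfX_lev_R κ Φ t p D mk gx fx hN hκ y qB hq hσ hΛ₁
  have hr : (0 : ℤ) ≤ ((fcells κ Φ t p D (gT mk gx κ Φ t p D) (fT mk fx κ Φ t p D)).r 1 : ℤ) := Nat.cast_nonneg _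
  exact ⟨by linarith, by linarith⟩

/-- **`hPf₂` of the y-family's x-prefix** (`σ = −1`): `−5r₁ + 1 ≤ −PHI₁`, `−PLO₁ ≤ 25r₁ − 1`. [cite: KozmaNitzan2024, §4 p. 28] -/
theorem hPfX₂_R (hN : EqNumL κ Φ t p D (gT mk gx κ Φ t p D) (fT mk fx κ Φ t p D)) (hκ : (hL κ Φ t p D (gT mk gx κ Φ t p D) (fT mk fx κ Φ t p D)).natAbs ≤ 10 * nL κ Φ t p D (gT mk gx κ Φ t p D) (fT mk fx κ Φ t p D))
    (y : Site 2) (qB : ℕ) (hq : 4 * qB ≤ nL κ Φ t p D (gT mk gx κ Φ t p D) (fT mk fx κ Φ t p D)) {σ : ℤ} (hσ : σ = 1 ∨ σ = -1)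
    (hΛ₁ : |Λ₁of κ Φ t p D (gT mk gx κ Φ t p D) (fT mk fx κ Φ t p D) y| ≤ 2 * modulus (nL κ Φ t p D (gT mk gx κ Φ t p D) (fT mk fx κ Φ t p D)) (hL κ Φ t p D (gT mk gx κ Φ t p D) (fT mk fx κ Φ t p D)) (vL κ Φ t p D (gT mk gx κ Φ t p D) (fT mk fx κ Φ t p D)) (Skelφ.NegPrm.vβOf (nL κ Φ t p D (gT mk gx κ Φ t p D) (fT mk fx κ Φ t p D)) (hL κ Φ t p D (gT mk gx κ Φ t p D) (fT mk fx κ Φ t p D)) (ℓL κ Φ t p D (gT mk gx κ Φ t p D) (fT mk fx κ Φ t p D)) (vL κ Φ t p D (gT mk gx κ Φ t p D) (fT mk fx κ Φ t p D)))) (hσ1 : σ = -1) :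
    -(5 * ((fcells κ Φ t p D (gT mk gx κ Φ t p D) (fT mk fx κ Φ t p D)).r 1 : ℤ)) + 1 ≤ -(TwoAxis.Para.coarse (20 * ((fcells κ Φ t p D (gT mk gx κ Φ t p D) (fT mk fx κ Φ t p D)).K : ℤ) * (((fcells κ Φ t p D (gT mk gx κ Φ t p D) (fT mk fx κ Φ t p D)).s 1 : ℕ) : ℤ)) (Skelφ.NegPrm.Dof (nL κ Φ t p D (gT mk gx κ Φ t p D) (fT mk fx κ Φ t p D)) (hL κ Φ t p D (gT mk gx κ Φ t p D) (fT mk fx κ Φ t p D)) (ℓL κ Φ t p D (gT mk gx κ Φ t p D) (fT mk fx κ Φ t p D)) (vL κ Φ t p D (gT mk gx κ Φ t p D) (fT mk fx κ Φ t p D)) / 2) (Skelφ.NegPrm.Dof (nL κ Φ t p D (gT mk gx κ Φ t p D) (fT mk fx κ Φ t p D)) (hL κ Φ t p D (gT mk gx κ Φ t p D) (fT mk fx κ Φ t p D)) (ℓL κ Φ t p D (gT mk gx κ Φ t p D) (fT mk fx κ Φ t p D)) (vL κ Φ t p D (gT mk gx κ Φ t p D) (fT mk fx κ Φ t p D)))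 (TwoAxis.Para.lam1 800 (nL κ Φ t p D (gT mk gx κ Φ t p D) (fT mk fx κ Φ t p D) : ℤ) (hL κ Φ t p D (gT mk gx κ Φ t p D) (fT mk fx κ Φ t p D)) y) +
        ((20 * ((fcells κ Φ t p D (gT mk gx κ Φ t p D) (fT mk fx κ Φ t p D)).K : ℤ) * (((fcells κ Φ t p D (gT mk gx κ Φ t p D) (fT mk fx κ Φ t p D)).s 1 : ℕ) : ℤ)) * (800 * ((shearUnit (nL κ Φ t p D (gT mk gx κ Φ t p D) (fT mk fx κ Φ t p D)) (hL κ Φ t p D (gT mk gx κ Φ t p D) (fT mk fx κ Φ t p D)) : ℤ) * (max (σ * (-pbHi κ Φ t p D (gT mk gx κ Φ t p D) (fT mk fx κ Φ t p D) mk 3)) (σ * (pbHi κ Φ t p D (gT mk gx κ Φ t p D) (fT mk fx κ Φ t p D) mk 3))) + (shearUnit (nL κ Φ t p D (gT mk gx κ Φ t p D) (fT mk fx κ Φ t p D)) (hL κ Φ t p D (gT mk gx κ Φ t p D) (fT mk fx κ Φ t p D)) : ℤ) - 1))) / (Skelφ.NegPrm.Dof (nL κ Φ t p D (gT mk gx κ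 Φ t p D) (fT mk fx κ Φ t p D)) (hL κ Φ t p D (gT mk gx κ Φ t p D) (fT mk fx κ Φ t p D)) (ℓL κ Φ t p D (gT mk gx κ Φ t p D) (fT mk fx κ Φ t p D)) (vL κ Φ t p D (gT mk gx κ Φ t p D) (fT mk fx κ Φ t p D))) + 1) ∧
      -(TwoAxis.Para.coarse (20 * ((fcells κ Φ t p D (gT mk gx κ Φ t p D) (fT mk fx κ Φ t p D)).K : ℤ) * (((fcells κ Φ t p D (gT mk gx κ Φ t p D) (fT mk fx κ Φ t p D)).s 1 : ℕ) : ℤ)) (Skelφ.NegPrm.Dof (nL κ Φ t p D (gT mk gx κ Φ t p D) (fT mk fx κ Φ t p D)) (hL κ Φ t p D (gT mk gx κ Φ t p D) (fT mk fx κ Φ t p D)) (ℓL κ Φ t p D (gT mk gx κ Φ t p D) (fT mk fx κ Φ t p D)) (vL κ Φ t p D (gT mk gx κ Φ t p D) (fT mk fx κ Φ t p D)) / 2) (Skelφ.NegPrm.Dof (nL κ Φ t p D (gT mk gx κ Φ t p D) (fT mk fx κ Φ t p D)) (hL κ Φ t p D (gT mk gx κ Φ t p D) (fT mk fx κ Φ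 t p D)) (ℓL κ Φ t p D (gT mk gx κ Φ t p D) (fT mk fx κ Φ t p D)) (vL κ Φ t p D (gT mk gx κ Φ t p D) (fT mk fx κ Φ t p D))) (TwoAxis.Para.lam1 800 (nL κ Φ t p D (gT mk gx κ Φ t p D) (fT mk fx κ Φ t p D) : ℤ) (hL κ Φ t p D (gT mk gx κ Φ t p D) (fT mk fx κ Φ t p D)) y) + ((20 * ((fcells κ Φ t p D (gT mk gx κ Φ t p D) (fT mk fx κ Φ t p D)).K : ℤ) * (((fcells κ Φ t p D (gT mk gx κ Φ t p D) (fT mk fx κ Φ t p D)).s 1 : ℕ) : ℤ)) * (800 * ((shearUnit (nL κ Φ t p D (gT mk gx κ Φ t p D) (fT mk fx κ Φ t p D)) (hL κ Φ t p D (gT mk gx κ Φ t p D) (fT mk fx κ Φ t p D)) : ℤ) * (min (σ * (-pbHi κ Φ t p D (gT mk gx κ Φ t p D) (fT mk fx κ Φ t p D) mk 3)) (σ * (pbHi κ Φ t p D (gT mk gx κ Φ t p D) (fT mk fx κ Φ t p D) mk 3)) - 1)))) / (Skelφ.NegPrm.Dof (nL κ Φ t p D (gT mk gx κ Φ t p D)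 (fT mk fx κ Φ t p D)) (hL κ Φ t p D (gT mk gx κ Φ t p D) (fT mk fx κ Φ t p D)) (ℓL κ Φ t p D (gT mk gx κ Φ t p D) (fT mk fx κ Φ t p D)) (vL κ Φ t p D (gT mk gx κ Φ t p D) (fT mk fx κ Φ t p D)))) ≤
        25 * ((fcells κ Φ t p D (gT mk gx κ Φ t p D) (fT mk fx κ Φ t p D)).r 1 : ℤ) - 1 := by
  have _h := hσ1
  obtain ⟨h1, h2⟩ := hPfX_lev_R κ Φ t p D mk gx fx hN hκ y qB hq hσ hΛ₁
  have hr : (0 : ℤ) ≤ ((fcells κ Φ t p D (gT mk gx κ Φ t p D) (fT mk fx κ Φ t p D)).r 1 : ℤ) := Nat.cast_nonneg _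
  exact ⟨by linarith, by linarith⟩

/-- **`hPf₃` of the y-family's x-prefix** (either `σ`, `Nx = 3`): the prism's fine abscissa within `±(5r₀ − 2)`. [cite: KozmaNitzan2024, §4 p. 28] -/
theorem hPfX₃_R (hN : EqNumL κ Φ t p D (gT mk gx κ Φ t p D) (fT mk fx κ Φ t p D)) (hκ : (hL κ Φ t p D (gT mk gx κ Φ t p D) (fT mk fx κ Φ t p D)).natAbs ≤ 10 * nL κ Φ t p D (gT mk gx κ Φ t p D) (fT mk fx κ Φ t p D))
    (y : Site 2) (qB : ℕ) (hq : 4 * qB ≤ nL κ Φ t p D (gT mk gx κ Φ t p D) (fT mk fx κ Φ t p D)) {σ : ℤ} (hσ : σ = 1 ∨ σ = -1)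
    (hΛ : |Λ₀of κ Φ t p D (gT mk gx κ Φ t p D) (fT mk fx κ Φ t p D) y| ≤ 3 * modulus (nL κ Φ t p D (gT mk gx κ Φ t p D) (fT mk fx κ Φ t p D)) (hL κ Φ t p D (gT mk gx κ Φ t p D) (fT mk fx κ Φ t p D)) (vL κ Φ t p D (gT mk gx κ Φ t p D) (fT mk fx κ Φ t p D)) (Skelφ.NegPrm.vβOf (nL κ Φ t p D (gT mk gx κ Φ t p D) (fT mk fx κ Φ t p D)) (hL κ Φ t p D (gT mk gx κ Φ t p D) (fT mk fx κ Φ t p D)) (ℓL κ Φ t p D (gT mk gx κ Φ t p D) (fT mk fx κ Φ t p D)) (vL κ Φ t p D (gT mk gx κ Φ t p D) (fT mk fx κ Φ t p D)))) :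
    -(5 * ((fcells κ Φ t p D (gT mk gx κ Φ t p D) (fT mk fx κ Φ t p D)).r 0 : ℤ) - 2) ≤ TwoAxis.Para.coarse (20 * ((fcells κ Φ t p D (gT mk gx κ Φ t p D) (fT mk fx κ Φ t p D)).K : ℤ) * (((fcells κ Φ t p D (gT mk gx κ Φ t p D) (fT mk fx κ Φ t p D)).s 0 : ℕ) : ℤ)) (Skelφ.NegPrm.Dof (nL κ Φ t p D (gT mk gx κ Φ t p D) (fT mk fx κ Φ t p D)) (hL κ Φ t p D (gT mk gx κ Φ t p D) (fT mk fx κ Φ t p D)) (ℓL κ Φ t p D (gT mk gx κ Φ t p D) (fT mk fx κ Φ t p D)) (vL κ Φ t p D (gT mk gx κ Φ t p D) (fT mk fx κ Φ t p D)) / 2) (Skelφ.NegPrm.Dof (nL κ Φ t p D (gT mk gx κ Φ t p D) (fT mk fx κ Φ t p D)) (hL κ Φ t p D (gT mk gx κ Φ t p D) (fT mk fx κ Φ t p D)) (ℓL κ Φ t p D (gT mk gx κ Φ t p D) (fT mk fx κ Φ t p D)) (vL κ Φ t p D (gT mk gx κ Φ t p D) (fT mk fx κ Φ t p D))) (TwoAxis.Para.lam0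 800 (vL κ Φ t p D (gT mk gx κ Φ t p D) (fT mk fx κ Φ t p D)) (Skelφ.NegPrm.vβOf (nL κ Φ t p D (gT mk gx κ Φ t p D) (fT mk fx κ Φ t p D)) (hL κ Φ t p D (gT mk gx κ Φ t p D) (fT mk fx κ Φ t p D)) (ℓL κ Φ t p D (gT mk gx κ Φ t p D) (fT mk fx κ Φ t p D)) (vL κ Φ t p D (gT mk gx κ Φ t p D) (fT mk fx κ Φ t p D))) y) +
        ((20 * ((fcells κ Φ t p D (gT mk gx κ Φ t p D) (fT mk fx κ Φ t p D)).K : ℤ) * (((fcells κ Φ t p D (gT mk gx κ Φ t p D) (fT mk fx κ Φ t p D)).s 0 : ℕ) : ℤ)) * (800 * (modulus (nL κ Φ t p D (gT mk gx κ Φ t p D) (fT mk fx κ Φ t p D)) (hL κ Φ t p D (gT mk gx κ Φ t p D) (fT mk fx κ Φ t p D)) (vL κ Φ t p D (gT mk gx κ Φ t p D) (fT mk fx κ Φ t p D)) (Skelφ.NegPrm.vβOf (nL κ Φ t p D (gT mk gx κ Φ t p D) (fT mk fx κ Φ t p D)) (hL κ Φ t p D (gT mk gx κ Φ t p D) (fT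 mk fx κ Φ t p D)) (ℓL κ Φ t p D (gT mk gx κ Φ t p D) (fT mk fx κ Φ t p D)) (vL κ Φ t p D (gT mk gx κ Φ t p D) (fT mk fx κ Φ t p D))) * (min (σ * (paLo κ Φ t p D (gT mk gx κ Φ t p D) (fT mk fx κ Φ t p D) mk qB 3)) (σ * (paHi κ Φ t p D (gT mk gx κ Φ t p D) (fT mk fx κ Φ t p D) mk qB 3))) -
          max ((vL κ Φ t p D (gT mk gx κ Φ t p D) (fT mk fx κ Φ t p D)) * ((shearUnit (nL κ Φ t p D (gT mk gx κ Φ t p D) (fT mk fx κ Φ t p D)) (hL κ Φ t p D (gT mk gx κ Φ t p D) (fT mk fx κ Φ t p D)) : ℤ) * (min (σ * (-pbHi κ Φ t p D (gT mk gx κ Φ t p D) (fT mk fx κ Φ t p D) mk 3)) (σ * (pbHi κ Φ t p D (gT mk gx κ Φ t p D) (fT mk fx κ Φ t p D) mk 3)) - 1))) ((vL κ Φ t p D (gT mk gx κ Φ t p D) (fT mk fx κ Φ t p D)) * ((shearUnit (nL κ Φ t p D (gT mk gx κ Φ t p D) (fT mk fx κ Φ t p D)) (hL κ Φ t p D (gT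 mk gx κ Φ t p D) (fT mk fx κ Φ t p D)) : ℤ) * (max (σ * (-pbHi κ Φ t p D (gT mk gx κ Φ t p D) (fT mk fx κ Φ t p D) mk 3)) (σ * (pbHi κ Φ t p D (gT mk gx κ Φ t p D) (fT mk fx κ Φ t p D) mk 3))) + (shearUnit (nL κ Φ t p D (gT mk gx κ Φ t p D) (fT mk fx κ Φ t p D)) (hL κ Φ t p D (gT mk gx κ Φ t p D) (fT mk fx κ Φ t p D)) : ℤ) - 1))) / (nL κ Φ t p D (gT mk gx κ Φ t p D) (fT mk fx κ Φ t p D) : ℤ))) / (Skelφ.NegPrm.Dof (nL κ Φ t p D (gT mk gx κ Φ t p D) (fT mk fx κ Φ t p D)) (hL κ Φ t p D (gT mk gx κ Φ t p D) (fT mk fx κ Φ t p D)) (ℓL κ Φ t p D (gT mk gx κ Φ t p D) (fT mk fx κ Φ t p D)) (vL κ Φ t p D (gT mk gx κ Φ t p D) (fT mk fx κ Φ t p D))) ∧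
      TwoAxis.Para.coarse (20 * ((fcells κ Φ t p D (gT mk gx κ Φ t p D) (fT mk fx κ Φ t p D)).K : ℤ) * (((fcells κ Φ t p D (gT mk gx κ Φ t p D) (fT mk fx κ Φ t p D)).s 0 : ℕ) : ℤ)) (Skelφ.NegPrm.Dof (nL κ Φ t p D (gT mk gx κ Φ t p D) (fT mk fx κ Φ t p D)) (hL κ Φ t p D (gT mk gx κ Φ t p D) (fT mk fx κ Φ t p D)) (ℓL κ Φ t p D (gT mk gx κ Φ t p D) (fT mk fx κ Φ t p D)) (vL κ Φ t p D (gT mk gx κ Φ t p D) (fT mk fx κ Φ t p D)) / 2) (Skelφ.NegPrm.Dof (nL κ Φ t p D (gT mk gx κ Φ t p D) (fT mk fx κ Φ t p D)) (hL κ Φ t p D (gT mk gx κ Φ t p D) (fT mk fx κ Φ t p D)) (ℓL κ Φ t p D (gT mk gx κ Φ t p D) (fT mk fx κ Φ t p D)) (vL κ Φ t p D (gT mk gx κ Φ t p D) (fT mk fx κ Φ t p D))) (TwoAxis.Para.lam0 800 (vL κ Φ t p D (gT mk gx κ Φ t p D) (fT mk fx κ Φ t p D)) (Skelφ.NegPrm.vβOf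 (nL κ Φ t p D (gT mk gx κ Φ t p D) (fT mk fx κ Φ t p D)) (hL κ Φ t p D (gT mk gx κ Φ t p D) (fT mk fx κ Φ t p D)) (ℓL κ Φ t p D (gT mk gx κ Φ t p D) (fT mk fx κ Φ t p D)) (vL κ Φ t p D (gT mk gx κ Φ t p D) (fT mk fx κ Φ t p D))) y) +
        ((20 * ((fcells κ Φ t p D (gT mk gx κ Φ t p D) (fT mk fx κ Φ t p D)).K : ℤ) * (((fcells κ Φ t p D (gT mk gx κ Φ t p D) (fT mk fx κ Φ t p D)).s 0 : ℕ) : ℤ)) * (800 * (modulus (nL κ Φ t p D (gT mk gx κ Φ t p D) (fT mk fx κ Φ t p D)) (hL κ Φ t p D (gT mk gx κ Φ t p D) (fT mk fx κ Φ t p D)) (vL κ Φ t p D (gT mk gx κ Φ t p D) (fT mk fx κ Φ t p D)) (Skelφ.NegPrm.vβOf (nL κ Φ t p D (gT mk gx κ Φ t p D) (fT mk fx κ Φ t p D)) (hL κ Φ t p D (gT mk gx κ Φ t p D) (fT mk fx κ Φ t p D)) (ℓL κ Φ t p D (gT mk gx κ Φ t p D) (fT mk fx κ Φ t p D)) (vL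 κ Φ t p D (gT mk gx κ Φ t p D) (fT mk fx κ Φ t p D))) * (max (σ * (paLo κ Φ t p D (gT mk gx κ Φ t p D) (fT mk fx κ Φ t p D) mk qB 3)) (σ * (paHi κ Φ t p D (gT mk gx κ Φ t p D) (fT mk fx κ Φ t p D) mk qB 3))) -
          min ((vL κ Φ t p D (gT mk gx κ Φ t p D) (fT mk fx κ Φ t p D)) * ((shearUnit (nL κ Φ t p D (gT mk gx κ Φ t p D) (fT mk fx κ Φ t p D)) (hL κ Φ t p D (gT mk gx κ Φ t p D) (fT mk fx κ Φ t p D)) : ℤ) * (min (σ * (-pbHi κ Φ t p D (gT mk gx κ Φ t p D) (fT mk fx κ Φ t p D) mk 3)) (σ * (pbHi κ Φ t p D (gT mk gx κ Φ t p D) (fT mk fx κ Φ t p D) mk 3)) - 1))) ((vL κ Φ t p D (gT mk gx κ Φ t p D) (fT mk fx κ Φ t p D)) * ((shearUnit (nL κ Φ t p D (gT mk gx κ Φ t p D) (fT mk fx κ Φ t p D)) (hL κ Φ t p D (gT mk gx κ Φ t p D) (fT mk fx κ Φ t p D)) : ℤ) * (max (σ * (-pbHi κ Φ t p D (gT mk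 gx κ Φ t p D) (fT mk fx κ Φ t p D) mk 3)) (σ * (pbHi κ Φ t p D (gT mk gx κ Φ t p D) (fT mk fx κ Φ t p D) mk 3))) + (shearUnit (nL κ Φ t p D (gT mk gx κ Φ t p D) (fT mk fx κ Φ t p D)) (hL κ Φ t p D (gT mk gx κ Φ t p D) (fT mk fx κ Φ t p D)) : ℤ) - 1))) / (nL κ Φ t p D (gT mk gx κ Φ t p D) (fT mk fx κ Φ t p D) : ℤ))) / (Skelφ.NegPrm.Dof (nL κ Φ t p D (gT mk gx κ Φ t p D) (fT mk fx κ Φ t p D)) (hL κ Φ t p D (gT mk gx κ Φ t p D) (fT mk fx κ Φ t p D)) (ℓL κ Φ t p D (gT mk gx κ Φ t p D) (fT mk fx κ Φ t p D)) (vL κ Φ t p D (gT mk gx κ Φ t p D) (fT mk fx κ Φ t p D))) + 1 ≤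
        5 * ((fcells κ Φ t p D (gT mk gx κ Φ t p D) (fT mk fx κ Φ t p D)).r 0 : ℤ) - 2 := by
  obtain ⟨hn1, hℓ1⟩ := one_le_of_eqNumL κ Φ t p D _ _ hN
  have hm0 := (Skelφ.NegPrm.modulus_vβOf hn1 (hL κ Φ t p D (gT mk gx κ Φ t p D) (fT mk fx κ Φ t p D)) (ℓL κ Φ t p D (gT mk gx κ Φ t p D) (fT mk fx κ Φ t p D)) (vL κ Φ t p D (gT mk gx κ Φ t p D) (fT mk fx κ Φ t p D))).1
  have hm : (nL κ Φ t p D (gT mk gx κ Φ t p D) (fT mk fx κ Φ t p D) : ℤ) * ((ℓL κ Φ t p D (gT mk gx κ Φ t p D) (fT mk fx κ Φ t p D) : ℤ) - 1) < modulus (nL κ Φ t p D (gT mk gx κ Φ t p D) (fT mk fx κ Φ t p D)) (hL κ Φ t p D (gT mk gx κ Φ t p D) (fT mk fx κ Φ t p D)) (vL κ Φ t p D (gT mk gx κ Φ t p D) (fT mk fx κ Φ t p D)) (Skelφ.NegPrm.vβOf (nL κ Φ t p D (gT mk gx κ Φ t p D) (fT mk fx κ Φ t p D)) (hL κ Φ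 t p D (gT mk gx κ Φ t p D) (fT mk fx κ Φ t p D)) (ℓL κ Φ t p D (gT mk gx κ Φ t p D) (fT mk fx κ Φ t p D)) (vL κ Φ t p D (gT mk gx κ Φ t p D) (fT mk fx κ Φ t p D))) := by linarith
  obtain ⟨hc0, hc1, hr0, hr1, hb0, hb1, hu0, hu1⟩ := units_eq κ Φ t p D (gT mk gx κ Φ t p D) (fT mk fx κ Φ t p D)
  have hv : |(vL κ Φ t p D (gT mk gx κ Φ t p D) (fT mk fx κ Φ t p D))| ≤ (nL κ Φ t p D (gT mk gx κ Φ t p D) (fT mk fx κ Φ t p D) : ℤ) := hN.v_le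
  have hn : (1 : ℤ) ≤ (nL κ Φ t p D (gT mk gx κ Φ t p D) (fT mk fx κ Φ t p D) : ℤ) := by exact_mod_cast hn1
  have hsu : (nL κ Φ t p D (gT mk gx κ Φ t p D) (fT mk fx κ Φ t p D) : ℤ) ≤ (shearUnit (nL κ Φ t p D (gT mk gx κ Φ t p D) (fT mk fx κ Φ t p D)) (hL κ Φ t p D (gT mk gx κ Φ t p D) (fT mk fx κ Φ t p D)) : ℤ) ∧ (shearUnit (nL κ Φ t p D (gT mk gx κ Φ t p D) (fT mk fx κ Φ t p D)) (hL κ Φ t p D (gT mk gx κ Φ t p D) (fT mk fx κ Φ t p D)) : ℤ) ≤ 11 * (nL κ Φ t p D (gT mk gx κ Φ t p D) (fT mk fx κ Φ t p D) : ℤ) := by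
    have h10 : ((((hL κ Φ t p D (gT mk gx κ Φ t p D) (fT mk fx κ Φ t p D))).natAbs : ℤ)) ≤ 10 * (nL κ Φ t p D (gT mk gx κ Φ t p D) (fT mk fx κ Φ t p D) : ℤ) := by exact_mod_cast hκ
    have h0 : (0 : ℤ) ≤ ((((hL κ Φ t p D (gT mk gx κ Φ t p D) (fT mk fx κ Φ t p D))).natAbs : ℤ)) := Nat.cast_nonneg _
    unfold Skelφ.shearUnit
    simp only [Nat.cast_add]
    constructor <;> linarith
  obtain ⟨hW, hLb⟩ := Wrun_spec κ Φ t p D (gT mk gx κ Φ t p D) (fT mk fx κ Φ t p D) hn1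
  have hW0 : (0 : ℤ) ≤ (Wrun κ Φ t p D (gT mk gx κ Φ t p D) (fT mk fx κ Φ t p D) : ℤ) := Nat.cast_nonneg _
  have hLb0 : (0 : ℤ) ≤ (Lbrun κ Φ t p D (gT mk gx κ Φ t p D) (fT mk fx κ Φ t p D) : ℤ) := Nat.cast_nonneg _
  have hRA : (0 : ℤ) ≤ (RA' κ Φ t p D mk : ℤ) := Nat.cast_nonneg _
  have hRAn : 2000 * ((RA' κ Φ t p D mk : ℤ) + 2) ≤ (nL κ Φ t p D (gT mk gx κ Φ t p D) (fT mk fx κ Φ t p D) : ℤ) := by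
    have := (nL_floorsT κ Φ t p D mk fx (gT mk gx κ Φ t p D)).2.1; exact_mod_cast this
  have hRAℓ : 22000 * ((RA' κ Φ t p D mk : ℤ) + 2) ≤ (ℓL κ Φ t p D (gT mk gx κ Φ t p D) (fT mk fx κ Φ t p D) : ℤ) := by
    have h1 : ((22000 * (RA' κ Φ t p D mk + 2) : ℕ) : ℤ) ≤ (ML κ Φ t p D (gT mk gx κ Φ t p D) : ℤ) := by exact_mod_cast (ML_floorsT κ Φ t p D mk gx).2.1
    have h2 := hN.ℓ_le
    push_cast at h1; linarith
  have hq0 : (0 : ℤ) ≤ (qB : ℤ) := Nat.cast_nonneg _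
  have hq' : 4 * (qB : ℤ) ≤ (nL κ Φ t p D (gT mk gx κ Φ t p D) (fT mk fx κ Φ t p D) : ℤ) := by exact_mod_cast hq
  unfold paLo paHi pbHi TwoAxis.Para.coarse
  rw [hc0, Dof_eq', (lam_eq κ Φ t p D (gT mk gx κ Φ t p D) (fT mk fx κ Φ t p D) y).1]
  have e3 : -(5 * ((fcells κ Φ t p D (gT mk gx κ Φ t p D) (fT mk fx κ Φ t p D)).r 0 : ℤ) - 2) = -(5 * (40 * u₀ κ Φ t p D (gT mk gx κ Φ t p D) (fT mk fx κ Φ t p D)) - 2) := by rw [hr0]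
  have e4 : 5 * ((fcells κ Φ t p D (gT mk gx κ Φ t p D) (fT mk fx κ Φ t p D)).r 0 : ℤ) - 2 = 5 * (40 * u₀ κ Φ t p D (gT mk gx κ Φ t p D) (fT mk fx κ Φ t p D)) - 2 := by rw [hr0]
  rw [e3, e4]
  rcases hσ with rfl | rfl
  · exact RootArith.prefix_pos' (u := u₀ κ Φ t p D (gT mk gx κ Φ t p D) (fT mk fx κ Φ t p D)) (Λ := Λ₀of κ Φ t p D (gT mk gx κ Φ t p D) (fT mk fx κ Φ t p D) y) (N := ((3 : ℕ) : ℤ)) hu0 hn hm hsu.1 hsu.2 hv hW hW0 hLb hLb0 hRA hRAn hRAℓ hq0 hq' (by norm_num) (by norm_num) hΛ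
  · obtain ⟨h1, h2⟩ := RootArith.prefix_neg' (u := u₀ κ Φ t p D (gT mk gx κ Φ t p D) (fT mk fx κ Φ t p D)) (Λ := Λ₀of κ Φ t p D (gT mk gx κ Φ t p D) (fT mk fx κ Φ t p D) y) (N := ((3 : ℕ) : ℤ)) hu0 hn hm hsu.1 hsu.2 hv hW hW0 hLb hLb0 hRA hRAn hRAℓ hq0 hq' (by norm_num) (by norm_num) hΛ
    exact ⟨by linarith, by linarith⟩

end AtT

end KS

end NegB

end PlanarSkeletonNeg

end Summit.CriticalPhenomena.PercolationContinuityZ3.Theorems.Transplant
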